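import Literature.MathematicalPhysics.QuantumFieldTheory.Balaban1983to89.B15Ineq131Input
import Literature.MathematicalPhysics.QuantumFieldTheory.Balaban1983to89.B14Ineq38Proof

/-!
# `Balaban1983to89.B15Ineq131From190` — [Balaban1989LargeFieldI] (1.31) p. 184 ON THE LATTICE MODEL END-TO-END FROM
# [15] (190): r12's `B15Ineq131Input.ineq131_input_of_ineq190_gamma` (the two `ℍ_{j,□}`-inputs *"this function and its
# covariant derivatives can be bounded by B₃exp(−δ2M₂R_j)22d²ε_j < (β/10)ε_j"* from (190) and γ) composed with p29's
# `B14Ineq38Proof.ineq131_lt` (the whole printed chain `|U_{j,□}(∂p) − 1| < … < ε_j(L^{k−j}η)²` on the ℤᵈ carriers of [14])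

statement-level skeleton of published theorems with citation tags; proofs where landed; nothing here is a claim about
the Yang–Mills mass gap.

CITATION HEADER (lean-in-tree rule 2026-08-18).  T. Bałaban, *Large field renormalization. I. The basic step of the 𝐑
operation*, Commun. Math. Phys. **122**, 175–202 (1989), doi:10.1007/BF01257412, bib `Balaban1989LargeFieldI` (cell paper
B15; PDF held `paper:balaban1989-cmp122-large-field-i`; pp. 183–184 = PDF 9–10, OCR `p0009.txt`/`p0010.txt` + x2 renders).
"[15]" = [Balaban1985Variational] (190) p. 308 (`B11SectG.Ineq190`); "[3]" = [Balaban1984PropagatorsII] (2.61)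
(`B11SectG.RowSum`); "[14]" = [Balaban1985LGTPropagators] (1.43)–(1.46) (`B8Ineq132`, `B8Eq146AExpansion`); "[III]" =
[Balaban1988Convergent] (2.5), (3.8) (`B14.IsRj`, `B14Ineq38Proof`).  WHAT IS REPRODUCED: SKELETON rows `B15.Eq1.31` and
`B15.Eq1.3–1.4` (*"Thus the functions (1.3) … are equal to 1"* at one plaquette), unit `lit-balaban-r12` gen 8, HOME
`run/shared/lean/pub/lit-balaban/` (`lit-balaban-r12/ROWS-B15.md`).  KNITTING — used BY NAME, nothing restated:
`B15Ineq131Input.ineq131_input_of_ineq190_gamma` (r12 g8), `B14Ineq38Proof.ineq131_lt` (p29 g6).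

THE PRINTED TEXT (pp. 183–184 [PDF 9–10], verbatim, re-read on the text layer and page image): *"The exponential decay property
of ℍ_{j,□} implies that on the cube □^∼ this function and its covariant derivatives can be bounded by B₃exp(−δ2M₂R_j)22d²ε_j <
(β/10)ε_j. Estimating ∂U_{j,□} as in (3.8) [III] we obtain |U_{j,□}(∂p) − 1| < (1 + (2β/10)ε_jξ)(1 − β½)ε_jξ² + (2β/10)ε_jξ²(1 +
(4β/10)ε_j) < (1 − β/2 + (2β/10)L^{−2} + 4β/10)ε_jξ² < ε_j(L^{k−j}η)² for p ⊂ □^∼. (1.31) Thus the functions (1.3) in the product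
on the left-hand side of (1.29) are equal to 1."*  (v1.1, r12 gen 19, `lit-balaban-r12/QUOTE-AUDIT-B15.md` finding A3: DOCSTRING
ONLY — v1 closed the quotation with the unprinted words «Thus the functions (1.3) with the new field U_k^{(n+1)} instead of U_k^{(n)}
are equal to 1» and dropped «∂U_{j,□}»; restored verbatim; no declaration, statement or proof changed.)

WHAT THIS FILE PROVES (kernel-checked, zero `sorry`; no `def`, no new `Prop`, no new named fact; axioms standard).
* `ineq131_lt_lattice_of_ineq190_gamma` — for p29's lattice expression `U_{j,□} = (e^{iξℍ}U₀)^{u⁻¹}` at the plaquette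
  `p = (x; μ, ν)`: `|U_{j,□}(∂p) − 1| < ε_jξ²`, with the six `ℍ`-inputs of `ineq131_lt` (the function at the four bonds of
  `∂p`, the two covariant derivatives) NOT assumed but DERIVED from [15] (190) for two block sizes `bout₀` (function) and
  `bout₁` (covariant derivative) at the base point `y` — (190) at every `t`, (2.61) at rate `σ`, `σ + τ ≤ ⅛δ₀`, the argument
  field of B-size `≤ 22d²ε_j` vanishing on the blocks closer than `D`, `δ2M₂R_j ≤ τD`, `Cκ_Bc ≤ B₃`, mean-value domination —
  the γ-step `B₃e^{−δ2M₂R_j}22d²ε_j < (β/10)ε_j` ((2.5) for `R_j`, `0 < g_j ≤ γ`, `log γ⁻² ≥ 1`, `δ2M₂ ≥ 1`, the clause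
  `B₃22d²γ² < β/10`), the DICTIONARY hypotheses (`hdom₁…₄`: `bout₀.loc y ℍB` dominates `|ℍ|` at the four bonds; `hdomD₁,₂`:
  `bout₁.loc y ℍB` dominates the two covariant derivatives), and p29's located inputs verbatim (`χ^{(n)}_k`-restriction
  `|U₀(∂p) − 1| < (1 − β½)ε_jξ²`, `0 < β ≤ 1`, `ε_j ≤ 1`, `L ≥ 2`, `ε_jξ ≤ L⁻²`).
HONEST SCOPE.  A composition; (190) and the dictionary are hypotheses; the lattice model is p29's (unitary-valued
configurations in a C⋆-algebra, self-adjoint `ℍ`).  NOT summit progress.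
-/

open NormedSpace Finset Complex

namespace Literature.MathematicalPhysics.QuantumFieldTheory.Balaban1983to89.B15Ineq131From190

open Literature.MathematicalPhysics.QuantumFieldTheory.Balaban1983to89
open B11SectG B7Prop1Explicit B15Ineq131Input B14Ineq38Proof

/-- **(1.31) ⇒ "the functions (1.3) … are equal to 1", ON THE LATTICE MODEL, FROM [15] (190) AND γ**
(`ineq131_lt ∘ ineq131_input_of_ineq190_gamma`, twice: function size and covariant-derivative size).
[cite: Balaban1989LargeFieldI, (1.31) p.184; Balaban1985Variational, (190) p.308] -/
theorem ineq131_lt_lattice_of_ineq190_gamma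
    -- [15]'s block-majorant data, two sizes
    {gB : B6.Geometry} {FB FA : Type} [AddCommGroup FB] [Module ℝ FB] [AddCommGroup FA] [Module ℝ FA]
    {T : Type*} {bB : BlockNorm gB FB} {bout₀ bout₁ : BlockNorm gB FA} {dH : T → FB →ₗ[ℝ] FA}
    {C δ₀ σ τ c D B₃ δ M₂ εj β γ gj : ℝ} {Lnat r R : ℕ}
    (h190₀ : ∀ t, Ineq190 bB bout₀ (dH t) C δ₀) (h190₁ : ∀ t, Ineq190 bB bout₁ (dH t) C δ₀) (hC : 0 ≤ C)
    (hd : ∀ a b : gB.Site, 0 ≤ gB.dist a b) (hrow : RowSum gB σ c) (hτ : 0 ≤ τ) (hστ : σ + τ ≤ δ₀ / 8)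
    (B : FB) (y : gB.Site)
    -- the lattice data (p29)
    {d : ℕ} {𝔸 : Type*} [CStarAlgebra 𝔸] [Nontrivial 𝔸]
    {ξ : ℝ} (hξ : 0 < ξ) {U₀ : B7Prop1Explicit.Site d → Fin d → 𝔸ˣ} (h₀ : ∀ z κ, U₀ z κ ∈ U1 𝔸)
    {H : B7Prop1Explicit.Site d → Fin d → 𝔸} (hH : ∀ z κ, IsSelfAdjoint (H z κ))
    {g : B7Prop1Explicit.Site d → 𝔸ˣ} (hg : ∀ z, g z ∈ U1 𝔸) (μ ν : Fin d) (x : B7Prop1Explicit.Site d) {L : ℝ}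
    (hm : ∀ y', bB.loc y' B ≤ 22 * (d : ℝ) ^ 2 * εj) (hD : ∀ y', bB.loc y' B ≠ 0 → D ≤ gB.dist y y')
    {HB : FA} (hmv₀ : ∀ s : ℝ, (∀ t, bout₀.loc y (dH t B) ≤ s) → bout₀.loc y HB ≤ s)
    (hmv₁ : ∀ s : ℝ, (∀ t, bout₁.loc y (dH t B) ≤ s) → bout₁.loc y HB ≤ s)
    (hgeom : δ * 2 * M₂ * R ≤ τ * D) (hCB : C * bB.κ * c ≤ B₃) (hB₃ : 0 ≤ B₃)
    -- γ data
    (hr : 1 ≤ r) (hR : B14.IsRj Lnat r gj R) (hgj : 0 < gj) (hgγ : gj ≤ γ) (hγe : 1 ≤ Real.log (γ ^ 2)⁻¹)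
    (hc1 : 1 ≤ δ * 2 * M₂) (hε : 0 < εj) (hγ : B₃ * (22 * (d : ℝ) ^ 2) * γ ^ 2 < β / 10)
    -- the dictionary
    (hdom₁ : ‖H x μ‖ ≤ bout₀.loc y HB) (hdom₂ : ‖H (x + e μ) ν‖ ≤ bout₀.loc y HB)
    (hdom₃ : ‖H (x + e ν) μ‖ ≤ bout₀.loc y HB) (hdom₄ : ‖H x ν‖ ≤ bout₀.loc y HB)
    (hdomD₁ : ‖B8Ineq132.covDerivFwd ξ U₀ μ (fun z => H z ν) x‖ ≤ bout₁.loc y HB)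
    (hdomD₂ : ‖B8Ineq132.covDerivFwd ξ U₀ ν (fun z => H z μ) x‖ ≤ bout₁.loc y HB)
    -- p29's located inputs
    (hβ0 : 0 < β) (hβ1 : β ≤ 1) (hε1 : εj ≤ 1) (hL : 2 ≤ L) (hεξ : εj * ξ ≤ (L ^ 2)⁻¹)
    (hdev₀ : ‖B8Ineq132.plaqF U₀ μ ν x - 1‖ < (1 - β / 2) * εj * ξ ^ 2) :
    ‖B8Ineq132.plaqF (gaugeAct g (B8Lemma1NonAbelian.mulCfg (B8Eq146AExpansion.expCfg
        (B8Eq146AExpansion.iEta ξ H)) U₀)) μ ν x - 1‖ < εj * ξ ^ 2 := by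
  have hb₀ := ineq131_input_of_ineq190_gamma h190₀ hC hd hrow hτ hστ B y hm hD hmv₀ hgeom hCB hB₃ hr hR hgj hgγ hγe
    hc1 hε hγ
  have hb₁ := ineq131_input_of_ineq190_gamma h190₁ hC hd hrow hτ hστ B y hm hD hmv₁ hgeom hCB hB₃ hr hR hgj hgγ hγe
    hc1 hε hγ
  exact ineq131_lt hξ h₀ hH hg μ ν x hβ0 hβ1 hε.le hε1 hL hεξ hdev₀ (hdom₁.trans hb₀.le) (hdom₂.trans hb₀.le)
    (hdom₃.trans hb₀.le) (hdom₄.trans hb₀.le) (hdomD₁.trans hb₁.le) (hdomD₂.trans hb₁.le)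

end Literature.MathematicalPhysics.QuantumFieldTheory.Balaban1983to89.B15Ineq131From190
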